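import Summits.CriticalPhenomena.PercolationContinuityZ3.Theorems.PercNearOneGluingNoHeavyQuantHyperscalingTransfers
import Summits.CriticalPhenomena.PercolationContinuityZ3.Theorems.PercNearOneGluingNoHeavyQuantPowerLawInputs
import Literature.Probability.Percolation.HutchcroftGammaLeDeltaSubOne
import HarnessLib

/-!
# PAPER-2 track, ARM-3 gen 3: `(T1)` with exponent `c > d/4` ⇒ the subcritical susceptibility input `γ' < 2` of route (C),
# modulo Hutchcroft's `γ ≤ δ − 1` (2020) — the converse after Question q:chi, with the two-box volume exponent

builds on p205010 (kernel theorem, internal audit signed; external expert review pending).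
Status sentence for p205010: "θ(p_c) = 0 on ℤ^d, all d ≥ 2 — kernel-verified (Lean 4/Mathlib, standard
axioms); internal adversarial audit SIGNED 2026-08-20 04:29Z; external expert review pending."

Seat `prim-quant-arm-3` (gen 3), `--supports stmt-CriticalPhenomena-4575`.  Notation: `P_p = bondPercolation (zdGraph d) p`,
`p_c = criticalProbI d`, `π_p(n) = oneArmProb d p n`, `χ(p) = chi d p = Σ_x τ_p(0,x)`.

The quantitative paper's §12 records, after its Question (subcritical susceptibility: `χ(p) ≤ M (p_c − p)^{−g}`, `g < 2`, i.e.
`Quant.SubcriticalGammaLtTwo d`), the converse "a bound `P_{p_c}(|C_0| ≥ n) ≤ C n^{−1/δ}` gives `χ(p) ≤ C''(p_c−p)^{1−δ}` [Hutchcroft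
2020, Thm 1.1]; by the (whole-box) volume lemma any `PolyArm_d(c)` yields a finite susceptibility exponent `≤ d/c − 1`, and a positive
answer if `c > d/3`".  Since `c ≤ d/3` for EVERY instance (`Quant.oneArmPolyDecayAtCritical_exponent_le_third`,
`…QuantHyperscalingTransfers`), that threshold is never met; with the two-box volume exponent `c/(d−c)` of the same file the converse
becomes non-vacuous:

* the NAMED FACT `Literature.Probability.Percolation.Hutchcroft2020_gamma_le_delta_sub_one` (`HutchcroftGammaLeDeltaSubOne.lean`, not
  proved): Hutchcroft 2020, Thm. 1.1 (second bullet, `k = 1`), on `ℤ^d`: if `P_{p_c}(|C_0| ≥ n) ≤ C n^{−1/δ}` for all `n ≥ 1` (`δ > 1`)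
  then there is `C'' > 0` with `χ(p) ≤ (C''/(p_c − p))^{δ−1}` for all `p < p_c`;
* **`Quant.subcriticalGammaLtTwo_of_oneArmPolyDecay`** — granted that fact: `OneArmPolyDecayAtCritical d c C` with **`c > d/4`** (`d ≥ 2`)
  implies `SubcriticalGammaLtTwo d`, with `g = d/c − 2 < 2` (volume exponent `a = c/(d−c)`, `δ' = 1/a = d/c − 1`, `γ' ≤ δ' − 1`);
* `Quant.chiSubcritPowerBound_of_oneArmPolyDecay` — the same with the constants named (`M = C''^{d/c−2}`, window `δ₀ = 1`).

Honest reading.  CONDITIONAL twice over: on (T1) with `c > d/4` (open for `3 ≤ d ≤ 10`; `d/4 = 0.75` in `d = 3`, above the predicted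
`0.48` — so, as the paper says, the converse restates the difficulty rather than reducing it, but it is no longer empty) and on the named
published fact (Hutchcroft's theorem, proved there for every transitive graph by the OSSS/two-ghost method; not formalised here).  The
chain `(T1)_c ⇒ γ' ≤ d/c − 2 ⇒ (T1)_{2 − d/(2c)}` (route (C), `…QuantOneArmOfChiSubcritical`) is strictly lossy in every `d ≥ 3`
(`2 − d/(2c) < c`), and exact only at `d = 6`, `c = 2` (`γ' ≤ 1`).  Nothing here is a rate.  Memo: POWERLAW-SURVEY.md §11 (gen 3).

## References
* T. Hutchcroft, *New critical exponent inequalities for percolation and the random cluster model*, Probab. Math. Phys. 1 (2020)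
  147–165 (arXiv:1901.10363): Thm. 1.1 [Hutchcroft2020].
* V. Dewan, S. Muirhead, PTRF 185 (2023), Thm. 1.1 [DewanMuirhead2022]; C. Borgs, J. T. Chayes, H. Kesten, J. Spencer, RSA 15 (1999) §1
  [BorgsChayesKestenSpencer1999].
-/

noncomputable section

open MeasureTheory Literature.Probability.Percolation Literature.Probability.LatticeModels

namespace Summit.CriticalPhenomena.PercolationContinuityZ3.Theorems.Quant

variable {d : ℕ}

/-- **(T1) with `c > d/4` ⇒ a subcritical susceptibility power bound with `g = d/c − 2 < 2`, constants named** (granted Hutchcroft's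
`γ ≤ δ − 1`): `OneArmPolyDecayAtCritical d c C`, `d ≥ 2`, `d/4 < c` ⟹ `∃ M, ChiSubcritPowerBound d M (d/c − 2) 1`.  Proof: the two-box
volume tail `P_{p_c}(|C_0| ≥ k) ≤ A k^{−c/(d−c)}` (`volumeTail_criticalProbI_of_oneArmPolyDecay`) is the hypothesis of the fact with
`δ' = (d−c)/c > 1` (as `c ≤ d/3`); its conclusion `χ(p) ≤ (C''/(p_c−p))^{δ'−1}` is `C''^{g} (p_c − p)^{−g}`, `g = δ' − 1 = d/c − 2`.
CONDITIONAL (on (T1) and on the named fact).  [cite: Hutchcroft2020, Thm. 1.1] -/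
theorem chiSubcritPowerBound_of_oneArmPolyDecay (hH : Hutchcroft2020_gamma_le_delta_sub_one) (hd : 2 ≤ d) {c C : ℝ}
    (hc : (d : ℝ) / 4 < c) (h : OneArmPolyDecayAtCritical d c C) :
    ∃ M : ℝ, ChiSubcritPowerBound d M ((d : ℝ) / c - 2) 1 := by
  have hd0 : (0 : ℝ) < d := by exact_mod_cast (show 0 < d by omega)
  have hc0 : 0 < c := lt_trans (by positivity) hc
  have hc3 := oneArmPolyDecayAtCritical_exponent_le_third hd h
  have hdc : 0 < (d : ℝ) - c := by linarith
  -- the volume tail, exponent `a = c/(d−c) = 1/δ'`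
  set δ' : ℝ := ((d : ℝ) - c) / c with hδ'
  have hδ'1 : 1 < δ' := by
    rw [hδ', lt_div_iff₀ hc0]; linarith
  have ha : c / ((d : ℝ) - c) = 1 / δ' := by rw [hδ']; field_simp
  have hA := volumeTail_criticalProbI_of_oneArmPolyDecay hd hc0 h
  set A : ℝ := (2 : ℝ) ^ c * C + (5 ^ d + 2 * d * 3 ^ (d - 1) * (16 : ℝ) ^ c * C ^ 2) with hAdef
  have hA' : ∀ n : ℕ, 1 ≤ n →
      (bondPercolation (zdGraph d) (criticalProbI d)).real (clusterSizeGe (0 : Site d) n) ≤ A * (n : ℝ) ^ (-(1 / δ')) := by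
    intro n hn
    have := hA n hn
    rwa [ha] at this
  obtain ⟨C'', hC''0, hχ⟩ := hH d (by omega) A δ' hδ'1 hA'
  -- `g = δ' − 1 = d/c − 2`
  have hg : δ' - 1 = (d : ℝ) / c - 2 := by rw [hδ']; field_simp; ring
  refine ⟨C'' ^ ((d : ℝ) / c - 2), fun q _ hq => ?_⟩
  have hpos : 0 < (criticalProbI d : ℝ) - q := by linarith
  have h1 := hχ q hq
  rw [hg, Real.div_rpow hC''0.le hpos.le] at h1
  rw [Real.rpow_neg hpos.le, ← div_eq_mul_inv]
  exact h1

/-- **(T1) with exponent `c > d/4` ⇒ `SubcriticalGammaLtTwo d`** (the input of route (C) / the paper's Question q:chi), granted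
Hutchcroft's `γ ≤ δ − 1`: from `chiSubcritPowerBound_of_oneArmPolyDecay` with `g = d/c − 2 < 2 ⟺ c > d/4`.  With the whole-box volume
exponent `c/d` the threshold would be `c > d/3`, which no instance satisfies (`oneArmPolyDecayAtCritical_exponent_le_third`); with the
two-box exponent it is `d/4` (`= 0.75` in `d = 3`, still above the predicted `0.48`; `= 1.5 < 2` at `d = 6`, where the chain is exact:
`γ' ≤ 1`).  CONDITIONAL (on (T1) with `c > d/4`, open for `3 ≤ d ≤ 10`, and on the named published fact).
[cite: Hutchcroft2020, Thm. 1.1] [cite: DewanMuirhead2022, Thm. 1.1] -/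
theorem subcriticalGammaLtTwo_of_oneArmPolyDecay (hH : Hutchcroft2020_gamma_le_delta_sub_one) (hd : 2 ≤ d) {c C : ℝ}
    (hc : (d : ℝ) / 4 < c) (h : OneArmPolyDecayAtCritical d c C) : SubcriticalGammaLtTwo d := by
  have hd0 : (0 : ℝ) < d := by exact_mod_cast (show 0 < d by omega)
  have hc0 : 0 < c := lt_trans (by positivity) hc
  obtain ⟨M, hM⟩ := chiSubcritPowerBound_of_oneArmPolyDecay hH hd hc h
  refine ⟨M, (d : ℝ) / c - 2, 1, ?_, one_pos, hM⟩
  have : (d : ℝ) / c < 4 := by rw [div_lt_iff₀ hc0]; linarith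
  linarith

/-- **The lossy loop through route (C)**: granted Hutchcroft's fact, `OneArmPolyDecayAtCritical d c C` with `c > d/4` gives back
`∃ C', OneArmPolyDecayAtCritical d (2 − d/(2c)) C'` (route (C)'s exponent `(2−g)/2` at `g = d/c − 2`) — strictly weaker than the
hypothesis in every `d ≥ 3` (`2 − d/(2c) < c` since `c + d/(2c) ≥ √(2d) > 2`): no bootstrap.  Bookkeeping; CONDITIONAL.
[cite: Hutchcroft2020, Thm. 1.1] [cite: Hutchcroft2022Triangle, Thm. 1.3] -/
theorem oneArmPolyDecayAtCritical_loop (hH : Hutchcroft2020_gamma_le_delta_sub_one) (hd : 2 ≤ d) {c C : ℝ}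
    (hc : (d : ℝ) / 4 < c) (h : OneArmPolyDecayAtCritical d c C) :
    ∃ C' : ℝ, OneArmPolyDecayAtCritical d (2 - (d : ℝ) / (2 * c)) C' := by
  have hd0 : (0 : ℝ) < d := by exact_mod_cast (show 0 < d by omega)
  have hc0 : 0 < c := lt_trans (by positivity) hc
  obtain ⟨M, hM⟩ := chiSubcritPowerBound_of_oneArmPolyDecay hH hd hc h
  have hg : (d : ℝ) / c - 2 < 2 := by
    have : (d : ℝ) / c < 4 := by rw [div_lt_iff₀ hc0]; linarith
    linarith
  obtain ⟨⟨C', hC'⟩, -⟩ := rates_of_chiSubcritPowerBound hd hg one_pos hM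
  refine ⟨C', ?_⟩
  have : (2 - ((d : ℝ) / c - 2)) / 2 = 2 - (d : ℝ) / (2 * c) := by field_simp; ring
  rwa [this] at hC'

end Summit.CriticalPhenomena.PercolationContinuityZ3.Theorems.Quant

end
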